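import Mathlib
import HarnessLib
import Literature.Analysis.FluidPDE.KNSSSwirlSupNonpos
import Literature.Analysis.FluidPDE.AncientMildWeakStar
import Summits.NavierStokesRegularity.NavierStokesRegularity.Theorems.HalfSpaceWindowDoorCirculationCarryingRigiditySubSwirl
import Summits.NavierStokesRegularity.NavierStokesRegularity.Theorems.HalfSpaceWindowDoorCirculationCarryingRigidityEddyTorqueMeasurePlateau
import Summits.NavierStokesRegularity.NavierStokesRegularity.Theorems.HalfSpaceWindowDoorCirculationCarryingRigidityEddyTorqueChainGeometry
import Summits.NavierStokesRegularity.NavierStokesRegularity.Theorems.AxisTwistDoorAveragedConeLiouvilleRadialDrift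
import Summits.NavierStokesRegularity.NavierStokesRegularity.Theorems.HalfSpaceWindowDoorCirculationCarryingRigidityEddyTorqueOneSided

/-!
# Route `HalfSpaceWindowDoor`, crux `CirculationCarryingRigidity` (stmt-NavierStokesRegularity-25311) — the ONE-SIDED
# eddy-torque engine, part 2a: the comparison function `M − F` of a swirl SUBSOLUTION pair (data of the positivity bricks)

Line `eddy_torque` (LEAD ns-hsw-p1 g5).  KNSS (Acta Math. 203 (2009), proof of Thm 5.3, (5.14)) obtain the plateau of a
near-maximal rescaled swirl from their Lemma 2.1, a statement about SOLUTIONS.  For the swirl SUBSOLUTION pairs of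
`…Defs.IsSubSwirl` (one-sided source slaved to `∂ᵣf ≥ 0`) the plateau comes instead from POSITIVITY PROPAGATION for the
supersolution `M − F ≥ 0` (sequel `…SubSwirlPlateau`).  This file supplies the data of that argument:

* `supersolution_data` / `pack` — off the tube `{r ≤ 3/4}`, `M − F` is a classical supersolution
  `∂ₜ(M−F) − Δ(M−F) + b·∇(M−F) ≥ 0` for the divergence-free `C¹` drift `b = u + ((2−A)/r²)x_h` (brick 0
  `…EddyTorqueOneSided` in the abstract), `‖b‖ ≤ (4/3)(C_u + |2−A|)`, in the input format of the bricks
  `…EddyTorqueMeasurePlateau.propagation_from_measure_along_chain` / `AxisTwistDoor…PositivityPropagationAffineC`;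
* `abs_sub_le_of_mem_ball` — the scale-invariant gradient bound makes the scalar `4C_g`-Lipschitz on balls about
  `K = {1 ≤ r ≤ 2, |z| ≤ L}` at box times `s ≤ τ − 1` (this is what removes the exceptional sets of the g4 blueprint: a point
  where `M − F > ε` gives a BALL where `M − F ≥ ε/2`);
* `measure_superlevel_ge` (a full ball has density `≥ 4`), `cylinder_subset`, `exists_steps` (integer bookkeeping of the chain),
  `time_lt_iff` (time correspondence of the rescaling).

Seat ns-hsw-p1 g5 (LEAD of 25311, cell pub-ns-dss).  WHAT THIS IS NOT: not a statement about Navier–Stokes regularity (Clay A); a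
linear parabolic tool about HYPOTHETICAL blow-up profiles; helper `--supports` 25311.
-/

noncomputable section

-- the summit and its single sub-problem share the name (CONVENTIONS §1), as in every Theorems file
set_option linter.dupNamespace false

namespace Summit.NavierStokesRegularity.NavierStokesRegularity.Theorems.HalfSpaceWindowDoorCirculationCarryingRigiditySubSwirlSupersolution

open MeasureTheory Set Function Filter Topology TopologicalSpace InnerProductSpace WithLp Metric
open scoped Laplacian RealInnerProductSpace ContDiff ENNReal
open Literature.Analysis Literature.Analysis.FluidPDE
open Summit.NavierStokesRegularity.NavierStokesRegularity.Theorems.HalfSpaceWindowDoorCirculationCarryingRigidityDefs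
open Summit.NavierStokesRegularity.NavierStokesRegularity.Theorems.HalfSpaceWindowDoorCirculationCarryingRigiditySubSwirl
open Summit.NavierStokesRegularity.NavierStokesRegularity.Theorems.HalfSpaceWindowDoorCirculationCarryingRigiditySubSwirl.IsSubSwirl
open Summit.NavierStokesRegularity.NavierStokesRegularity.Theorems.HalfSpaceWindowDoorCirculationCarryingRigidityEddyTorqueMeasurePlateau
  (propagation_from_measure_along_chain positivityPropagationAffineC_holds)
open Summit.NavierStokesRegularity.NavierStokesRegularity.Theorems.HalfSpaceWindowDoorCirculationCarryingRigidityEddyTorqueChainGeometry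
  (exists_chain)
open Summit.NavierStokesRegularity.NavierStokesRegularity.Theorems.AveragedConeLiouville.RadialDrift
  (norm_horizontal norm_radialDrift_le divergence_radialDrift contDiffOn_radialDrift)
open Summit.NavierStokesRegularity.NavierStokesRegularity.Theorems.HalfSpaceWindowDoorCirculationCarryingRigidityEddyTorqueOneSided
  (horizontal_eq_smul_eR)

namespace IsSubSwirl

variable {Cf Cu Cg A τ : ℝ} {F : ℝ → (EuclideanSpace ℝ (Fin 3)) → ℝ}
  {V : ℝ → (EuclideanSpace ℝ (Fin 3)) → (EuclideanSpace ℝ (Fin 3))}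

/-! ### The comparison function `M − F` and its drift -/

/-- **`V = M − F` IS A CLASSICAL SUPERSOLUTION WITH A BOUNDED DIVERGENCE-FREE `C¹` DRIFT off the tube `{r ≤ 3/4}`** (the
abstract form of brick 0, `…EddyTorqueOneSided`): for a swirl subsolution pair on `(−∞, τ)` with `F ≤ M` there, with
`U = (−∞,τ) × {r > 1/2}` and `b = u + ((2−A)/r²)x_h`: `U` is open, `M − F ∈ C²(U)`, `b ∈ C¹(U)`, and at every `s < τ`,
`r(y) > 3/4`: `‖b‖ ≤ (4/3)(C_u + |2−A|)`, `div b = 0`, `M − F ≥ 0`, `∂ₜ(M−F) − Δ(M−F) + ⟪b, ∇(M−F)⟫ ≥ 0`. -/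
theorem supersolution_data (hP : IsSubSwirl Cf Cu Cg A τ F V) {M : ℝ} (hFM : ∀ s < τ, ∀ y, F s y ≤ M) :
    IsOpen (Iio τ ×ˢ {y : EuclideanSpace ℝ (Fin 3) | 1 / 2 < cylRadius y}) ∧
    ContDiffOn ℝ 2 (uncurry fun s (y : EuclideanSpace ℝ (Fin 3)) => M - F s y)
      (Iio τ ×ˢ {y : EuclideanSpace ℝ (Fin 3) | 1 / 2 < cylRadius y}) ∧
    ContDiffOn ℝ 1 (uncurry fun s (y : EuclideanSpace ℝ (Fin 3)) => V s y + ((2 - A) / cylRadius y ^ 2) •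
      (y 0 • EuclideanSpace.single (0 : Fin 3) (1 : ℝ) + y 1 • EuclideanSpace.single (1 : Fin 3) (1 : ℝ)))
      (Iio τ ×ˢ {y : EuclideanSpace ℝ (Fin 3) | 1 / 2 < cylRadius y}) ∧
    ∀ s < τ, ∀ y : EuclideanSpace ℝ (Fin 3), 3 / 4 < cylRadius y →
      ‖V s y + ((2 - A) / cylRadius y ^ 2) •
          (y 0 • EuclideanSpace.single (0 : Fin 3) (1 : ℝ) + y 1 • EuclideanSpace.single (1 : Fin 3) (1 : ℝ))‖ ≤
        4 / 3 * (Cu + |2 - A|) ∧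
      VectorCalculus.divergence (fun y : EuclideanSpace ℝ (Fin 3) => V s y + ((2 - A) / cylRadius y ^ 2) •
          (y 0 • EuclideanSpace.single (0 : Fin 3) (1 : ℝ) + y 1 • EuclideanSpace.single (1 : Fin 3) (1 : ℝ))) y = 0 ∧
      0 ≤ M - F s y ∧
      0 ≤ deriv (fun σ => M - F σ y) s - (Δ (fun y' => M - F s y')) y +
        ⟪V s y + ((2 - A) / cylRadius y ^ 2) •
            (y 0 • EuclideanSpace.single (0 : Fin 3) (1 : ℝ) + y 1 • EuclideanSpace.single (1 : Fin 3) (1 : ℝ)),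
          gradient (fun y' => M - F s y') y⟫_ℝ := by
  have hU : IsOpen (Iio τ ×ˢ {y : EuclideanSpace ℝ (Fin 3) | 1 / 2 < cylRadius y}) :=
    isOpen_Iio.prod (isOpen_lt continuous_const continuous_cylRadius)
  refine ⟨hU, ?_, ?_, ?_⟩
  · -- `M − F ∈ C²(U)`
    have hF : ContDiffOn ℝ 2 (uncurry F) (Iio τ ×ˢ {y : EuclideanSpace ℝ (Fin 3) | 1 / 2 < cylRadius y}) :=
      (hP.smooth_joint.of_le (by norm_cast)).mono (prod_mono Subset.rfl (subset_univ _))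
    have e : (uncurry fun s (y : EuclideanSpace ℝ (Fin 3)) => M - F s y) = fun p => M - uncurry F p := by
      funext p; rfl
    rw [e]
    exact contDiffOn_const.sub hF
  · -- `b ∈ C¹(U)`
    have hV : ContDiffOn ℝ 1 (uncurry V) (Iio τ ×ˢ {y : EuclideanSpace ℝ (Fin 3) | 1 / 2 < cylRadius y}) :=
      (hP.smooth_drift_joint.of_le (by norm_cast)).mono (prod_mono Subset.rfl (subset_univ _))
    have hR := (contDiffOn_radialDrift (2 - A) (by norm_num : (0:ℝ) < 1 / 2)).comp contDiff_snd.contDiffOn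
      (fun p (hp : p ∈ Iio τ ×ˢ {y : EuclideanSpace ℝ (Fin 3) | 1 / 2 < cylRadius y}) => hp.2)
    exact hV.add hR
  · intro s hs y hy
    have hr0 : cylRadius y ≠ 0 := by intro h; rw [h] at hy; norm_num at hy
    have hr : 0 < cylRadius y := lt_of_le_of_ne (cylRadius_nonneg y) (Ne.symm hr0)
    have hF2 : ContDiff ℝ 2 (F s) := (hP.smooth s hs).of_le (by norm_cast)
    refine ⟨?_, ?_, ?_, ?_⟩
    · -- drift bound
      have h1 : ‖V s y‖ ≤ 4 / 3 * Cu := by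
        have hd := hP.drift_le s hs y
        have hCu := Cu_nonneg hP
        rw [show 4 / 3 * Cu = Cu / (3 / 4) by ring, le_div_iff₀ (by norm_num : (0:ℝ) < 3 / 4)]
        nlinarith [norm_nonneg (V s y)]
      have h2 := norm_radialDrift_le (2 - A) (by norm_num : (0:ℝ) < 3 / 4) hy
      calc _ ≤ ‖V s y‖ + ‖((2 - A) / cylRadius y ^ 2) •
            (y 0 • EuclideanSpace.single (0 : Fin 3) (1 : ℝ) + y 1 • EuclideanSpace.single (1 : Fin 3) (1 : ℝ))‖ :=
            norm_add_le _ _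
        _ ≤ 4 / 3 * Cu + |2 - A| / (3 / 4) := add_le_add h1 h2
        _ = 4 / 3 * (Cu + |2 - A|) := by ring
    · -- divergence free
      have h1 : DifferentiableAt ℝ (V s) y := ((hP.smooth_drift s hs).differentiable (by simp)).differentiableAt
      have hopen : IsOpen {y' : EuclideanSpace ℝ (Fin 3) | cylRadius y / 2 < cylRadius y'} :=
        isOpen_lt continuous_const continuous_cylRadius
      have hmem : y ∈ {y' : EuclideanSpace ℝ (Fin 3) | cylRadius y / 2 < cylRadius y'} := by
        show cylRadius y / 2 < cylRadius y; linarith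
      have h2 : DifferentiableAt ℝ (fun y' : EuclideanSpace ℝ (Fin 3) => ((2 - A) / cylRadius y' ^ 2) •
          (y' 0 • EuclideanSpace.single (0 : Fin 3) (1 : ℝ) + y' 1 • EuclideanSpace.single (1 : Fin 3) (1 : ℝ))) y :=
        ((contDiffOn_radialDrift (2 - A) (half_pos hr)).differentiableOn one_ne_zero y hmem).differentiableAt
          (hopen.mem_nhds hmem)
      have hsum : HasFDerivAt (fun y' : EuclideanSpace ℝ (Fin 3) => V s y' + ((2 - A) / cylRadius y' ^ 2) •
            (y' 0 • EuclideanSpace.single (0 : Fin 3) (1 : ℝ) + y' 1 • EuclideanSpace.single (1 : Fin 3) (1 : ℝ)))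
          (fderiv ℝ (V s) y + fderiv ℝ (fun y' : EuclideanSpace ℝ (Fin 3) => ((2 - A) / cylRadius y' ^ 2) •
            (y' 0 • EuclideanSpace.single (0 : Fin 3) (1 : ℝ) + y' 1 • EuclideanSpace.single (1 : Fin 3) (1 : ℝ))) y) y :=
        h1.hasFDerivAt.add h2.hasFDerivAt
      rw [VectorCalculus.divergence, hsum.fderiv, ContinuousLinearMap.toLinearMap_add, map_add]
      have hA := hP.divFree s hs y
      have hB := divergence_radialDrift (2 - A) hr0
      rw [VectorCalculus.divergence] at hA hB
      rw [hA, hB, add_zero]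
    · linarith [hFM s hs y]
    · -- the supersolution inequality from `sub_radial'`
      have hsub := sub_radial' hP hs hr0
      have hdt : deriv (fun σ => M - F σ y) s = -deriv (fun σ => F σ y) s := by
        rw [show (fun σ => M - F σ y) = fun σ => M - (fun σ => F σ y) σ from rfl, deriv_const_sub]
      have hΔ : (Δ (fun y' => M - F s y')) y = -(Δ (F s)) y := by
        have e : (fun y' => M - F s y') = (fun _ => M) - F s := rfl
        rw [e, ContDiffAt.laplacian_sub contDiffAt_const hF2.contDiffAt]
        simp [InnerProductSpace.laplacian_const]
      have hgrad : gradient (fun y' => M - F s y') y = -gradient (F s) y := by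
        rw [gradient, gradient, show (fun y' => M - F s y') = fun y' => M - (F s) y' from rfl, fderiv_const_sub, map_neg]
      have hinner : ∀ w : EuclideanSpace ℝ (Fin 3), ⟪w, gradient (F s) y⟫_ℝ = fderiv ℝ (F s) y w := by
        intro w
        rw [gradient, real_inner_comm, InnerProductSpace.toDual_symm_apply]
      rw [hdt, hΔ, hgrad, inner_neg_right, hinner, map_add, map_smul, horizontal_eq_smul_eR hr0, map_smul, smul_eq_mul,
        smul_eq_mul]
      have e : (2 - A) / cylRadius y ^ 2 * (cylRadius y * fderiv ℝ (F s) y (eR y)) =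
          (2 - A) / cylRadius y * fderiv ℝ (F s) y (eR y) := by
        field_simp
      rw [e]
      linarith [hsub]

/-! ### The gradient bound makes the scalar uniformly Lipschitz near `K` at box times `≤ τ − 1` -/

/-- **`|F(s,y) − F(s,y₁)| ≤ 4 C_g ‖y − y₁‖` on `B(y₁, ρ)`** for `r(y₁) ≤ 2`, `ρ ≤ 1/2`, `s ≤ τ − 1` (mean value inequality with
`‖∇F‖ ≤ C_g(1/√(τ−s) + r/(τ−s)) ≤ C_g(1 + 3)` on the ball). -/
theorem abs_sub_le_of_mem_ball (hP : IsSubSwirl Cf Cu Cg A τ F V) {s : ℝ} (hs : s ≤ τ - 1)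
    {y₁ : EuclideanSpace ℝ (Fin 3)} (hy₁ : cylRadius y₁ ≤ 2) {ρ : ℝ} (hρ : ρ ≤ 1 / 2)
    {y : EuclideanSpace ℝ (Fin 3)} (hy : y ∈ ball y₁ ρ) :
    |F s y - F s y₁| ≤ 4 * Cg * ‖y - y₁‖ := by
  have hsτ : s < τ := by linarith
  have hCg := Cg_nonneg hP
  have hdiff : ∀ z ∈ ball y₁ ρ, DifferentiableAt ℝ (F s) z := fun z _ =>
    ((hP.smooth s hsτ).differentiable (by simp)).differentiableAt
  have hbound : ∀ z ∈ ball y₁ ρ, ‖fderiv ℝ (F s) z‖ ≤ 4 * Cg := by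
    intro z hz
    have hz' : cylRadius z ≤ 3 := by
      have h1 := cylRadius_le_cylRadius_add_norm_sub y₁ z
      have h2 : ‖z - y₁‖ < ρ := by rwa [← dist_eq_norm]
      linarith
    have h1 : 1 ≤ τ - s := by linarith
    have hsq : 1 ≤ Real.sqrt (τ - s) := by
      rw [show (1:ℝ) = Real.sqrt 1 by simp]; exact Real.sqrt_le_sqrt h1
    have ha : 1 / Real.sqrt (τ - s) ≤ 1 := by
      rw [div_le_one (by linarith)]; exact hsq
    have hb : cylRadius z / (τ - s) ≤ 3 := by
      rw [div_le_iff₀ (by linarith)]; nlinarith [cylRadius_nonneg z]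
    calc ‖fderiv ℝ (F s) z‖ ≤ Cg * (1 / Real.sqrt (τ - s) + cylRadius z / (τ - s)) := hP.grad_le s hsτ z
      _ ≤ Cg * (1 + 3) := mul_le_mul_of_nonneg_left (add_le_add ha hb) hCg
      _ = 4 * Cg := by ring
  have h := (convex_ball y₁ ρ).norm_image_sub_le_of_norm_fderiv_le hdiff hbound (mem_ball_self (by
    have := mem_ball.1 hy; linarith [dist_nonneg (x := y) (y := y₁)])) hy
  rw [Real.norm_eq_abs] at h
  exact h

/-! ### A full ball has density `≥ 4` -/

/-- If `V(t̄,·) ≥ λ` on the whole ball `B(x₀, ρ)`, the superlevel set has measure `≥ 4ρ³` there (`|B_ρ| = (4π/3)ρ³`). -/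
theorem measure_superlevel_ge {W : EuclideanSpace ℝ (Fin 3) → ℝ} {x₀ : EuclideanSpace ℝ (Fin 3)} {ρ lam : ℝ} (hρ : 0 < ρ)
    (hW : ∀ y ∈ ball x₀ ρ, lam ≤ W y) :
    ENNReal.ofReal (4 * ρ ^ 3) ≤ volume {y : EuclideanSpace ℝ (Fin 3) | y ∈ ball x₀ ρ ∧ lam ≤ W y} := by
  have hset : {y : EuclideanSpace ℝ (Fin 3) | y ∈ ball x₀ ρ ∧ lam ≤ W y} = ball x₀ ρ := by
    ext y; exact ⟨fun h => h.1, fun h => ⟨h, hW y h⟩⟩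
  rw [hset, EuclideanSpace.volume_ball_fin_three, ← ENNReal.ofReal_pow hρ.le, ← ENNReal.ofReal_mul (by positivity)]
  refine ENNReal.ofReal_le_ofReal ?_
  have hπ : (4:ℝ) ≤ Real.pi * 4 / 3 := by nlinarith [Real.pi_gt_three]
  nlinarith [pow_pos hρ 3]


/-! ### The plateau -/

/-- Time bookkeeping of the rescaling: box time `s` corresponds to the original time `t* + λ²(s − T₁)`, which is negative iff
`s < T₁ + (0 − t*)/λ²`. -/
theorem time_lt_iff {lam tstar T₁ s : ℝ} (hlam : 0 < lam) :
    tstar + lam ^ 2 * (s - T₁) < 0 ↔ s < T₁ + (0 - tstar) / lam ^ 2 := by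
  have h2 : 0 < lam ^ 2 := by positivity
  constructor
  · intro h
    have h3 : s - T₁ < (0 - tstar) / lam ^ 2 := by rw [lt_div_iff₀ h2]; linarith
    linarith
  · intro h
    have h3 : s - T₁ < (0 - tstar) / lam ^ 2 := by linarith
    rw [lt_div_iff₀ h2] at h3
    linarith

/-- Off-axis control near `K`: a point within distance `≤ 1/8`… in fact `< 1/2` of a point with `r ≥ 1` has `r > 1/2`. -/
theorem half_lt_cylRadius_of_dist_lt {x y : EuclideanSpace ℝ (Fin 3)} (hx : 1 ≤ cylRadius x) (hd : dist y x < 1 / 2) :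
    1 / 2 < cylRadius y := by
  have h := cylRadius_le_cylRadius_add_norm_sub y x
  rw [← dist_eq_norm, dist_comm] at h
  linarith

/-- Likewise with `dist < 1/4`: `r > 3/4`. -/
theorem threeFourth_lt_cylRadius_of_dist_lt {x y : EuclideanSpace ℝ (Fin 3)} (hx : 1 ≤ cylRadius x) (hd : dist y x < 1 / 4) :
    3 / 4 < cylRadius y := by
  have h := cylRadius_le_cylRadius_add_norm_sub y x
  rw [← dist_eq_norm, dist_comm] at h
  linarith

/-- **Integer bookkeeping of the chain**: with the step budget `u₀ (n_max + 6) ≤ 8` and a time gap `D > 1` there is a number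
of steps `N ≥ n_max`, `N ≤ 8T/u₀ + 8`, with `D < (N+6)u₀/8 ≤ D + u₀/8` (take `N = ⌊8D/u₀⌋ − 5`). -/
theorem exists_steps {u₀ nmax D T : ℝ} (hu₀ : 0 < u₀) (hn : 0 < nmax) (hbudget : u₀ * (nmax + 6) ≤ 8)
    (hD : 1 < D) (hDT : D ≤ T + u₀) :
    ∃ N : ℕ, nmax ≤ N ∧ (N : ℝ) ≤ 8 * T / u₀ + 8 ∧ D < ((N : ℝ) + 6) * u₀ / 8 ∧ ((N : ℝ) + 6) * u₀ / 8 ≤ D + u₀ / 8 := by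
  obtain ⟨m, hm⟩ : ∃ m : ℕ, m = ⌊8 * D / u₀⌋₊ := ⟨_, rfl⟩
  have hmle : (m : ℝ) ≤ 8 * D / u₀ := by rw [hm]; exact Nat.floor_le (by positivity)
  have hmlt : 8 * D / u₀ < m + 1 := by rw [hm]; exact Nat.lt_floor_add_one _
  have hmle' : (m : ℝ) * u₀ ≤ 8 * D := by rwa [le_div_iff₀ hu₀] at hmle
  have hmlt' : 8 * D < (m + 1) * u₀ := by rwa [div_lt_iff₀ hu₀] at hmlt
  have h8 : nmax + 6 ≤ 8 / u₀ := by rw [le_div_iff₀ hu₀]; linarith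
  have h8D : 8 / u₀ ≤ 8 * D / u₀ := div_le_div_of_nonneg_right (by linarith) hu₀.le
  have hm_large : nmax + 5 ≤ (m : ℝ) := by linarith
  have hm5 : 5 ≤ m := by
    have : (5 : ℝ) ≤ m := by linarith
    exact_mod_cast this
  refine ⟨m - 5, ?_, ?_, ?_, ?_⟩
  · push_cast [Nat.cast_sub hm5]; linarith
  · push_cast [Nat.cast_sub hm5]
    have : 8 * D / u₀ ≤ 8 * T / u₀ + 8 := by
      rw [div_add' _ _ _ hu₀.ne', div_le_div_iff_of_pos_right hu₀]; linarith
    linarith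
  · push_cast [Nat.cast_sub hm5]; nlinarith
  · push_cast [Nat.cast_sub hm5]; nlinarith

/-- The brick data on a ball of radius `≤ 1/4` about a point with `r ≥ 1` (so the ball stays in `{r > 3/4}`), with any drift
constant `Λ' ≥ (4/3)(C_u + |2−A|)`. -/
theorem pack (hP : IsSubSwirl Cf Cu Cg A τ F V) {M : ℝ} (hFM : ∀ s < τ, ∀ y, F s y ≤ M)
    {c : EuclideanSpace ℝ (Fin 3)} (hc : 1 ≤ cylRadius c) {R : ℝ} (hR : R ≤ 1 / 4) {Λ' : ℝ}
    (hΛ' : 4 / 3 * (Cu + |2 - A|) ≤ Λ') {t : ℝ} (ht : t < τ) {y : EuclideanSpace ℝ (Fin 3)} (hy : y ∈ ball c R) :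
    ‖V t y + ((2 - A) / cylRadius y ^ 2) •
        (y 0 • EuclideanSpace.single (0 : Fin 3) (1 : ℝ) + y 1 • EuclideanSpace.single (1 : Fin 3) (1 : ℝ))‖ ≤ Λ' ∧
    VectorCalculus.divergence (fun y : EuclideanSpace ℝ (Fin 3) => V t y + ((2 - A) / cylRadius y ^ 2) •
        (y 0 • EuclideanSpace.single (0 : Fin 3) (1 : ℝ) + y 1 • EuclideanSpace.single (1 : Fin 3) (1 : ℝ))) y = 0 ∧
    0 ≤ M - F t y ∧
    0 ≤ deriv (fun σ => M - F σ y) t - (Δ (fun y' => M - F t y')) y +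
      ⟪V t y + ((2 - A) / cylRadius y ^ 2) •
          (y 0 • EuclideanSpace.single (0 : Fin 3) (1 : ℝ) + y 1 • EuclideanSpace.single (1 : Fin 3) (1 : ℝ)),
        gradient (fun y' => M - F t y') y⟫_ℝ := by
  have hy' : 3 / 4 < cylRadius y := threeFourth_lt_cylRadius_of_dist_lt hc (lt_of_lt_of_le (mem_ball.1 hy) hR)
  obtain ⟨h1, h2, h3, h4⟩ := (supersolution_data hP hFM).2.2.2 t ht y hy'
  exact ⟨h1.trans hΛ', h2, h3, h4⟩

/-- Closed cylinders of radius `≤ 1/4` about points with `r ≥ 1`, at times `< τ`, lie in `(−∞,τ) × {r > 1/2}`. -/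
theorem cylinder_subset {τ : ℝ} {c : EuclideanSpace ℝ (Fin 3)} (hc : 1 ≤ cylRadius c) {R : ℝ} (hR : R ≤ 1 / 4) (a : ℝ)
    {b : ℝ} (hb : b < τ) :
    Icc a b ×ˢ closedBall c R ⊆ Iio τ ×ˢ {y : EuclideanSpace ℝ (Fin 3) | 1 / 2 < cylRadius y} := by
  intro p hp
  refine ⟨lt_of_le_of_lt hp.1.2 hb, ?_⟩
  have : dist p.2 c ≤ R := mem_closedBall.1 hp.2
  exact half_lt_cylRadius_of_dist_lt hc (by linarith)

/-- `B₀ ≤ Λ/R` for `Λ = 4|B₀|ρ`, `0 < R ≤ ρ`… the three instances used. -/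
theorem driftConst_le_div {B₀ ρ R : ℝ} (hR : 0 < R) (hRρ : R ≤ 4 * ρ) : B₀ ≤ 4 * |B₀| * ρ / R := by
  rw [le_div_iff₀ hR]
  calc B₀ * R ≤ |B₀| * R := mul_le_mul_of_nonneg_right (le_abs_self _) hR.le
    _ ≤ |B₀| * (4 * ρ) := mul_le_mul_of_nonneg_left hRρ (abs_nonneg _)
    _ = 4 * |B₀| * ρ := by ring

end IsSubSwirl

end Summit.NavierStokesRegularity.NavierStokesRegularity.Theorems.HalfSpaceWindowDoorCirculationCarryingRigiditySubSwirlSupersolution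

end
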